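import Mathlib.Analysis.Complex.CauchyIntegral
import Mathlib.Analysis.Calculus.IteratedDeriv.Lemmas
import Mathlib.Analysis.Calculus.Deriv.Mul
import Mathlib.LinearAlgebra.Matrix.Determinant.Basic
import Mathlib.Algebra.BigOperators.Intervals
import Literature.NumberTheory.Transcendental.BakerLogarithmsAnalytic
import HarnessLib

/-!
# Laurent's lemma on interpolation determinants

Topic `Literature/NumberTheory/Transcendental`. The analytic half of M. Laurent's method of
interpolation determinants (Laurent 1994; Laurent–Mignotte–Nesterenko 1995; Waldschmidt,
*Diophantine Approximation on Linear Algebraic Groups*, §2.2; Baker–Wüstholz 2007, §2.8 p. 35): for entire functions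
`f₁, …, f_N`, points `ζ₁, …, ζ_N` of modulus `≤ r` and `E ≥ 1`,

  `|det (f_j(ζ_i))| ≤ E^{-N(N-1)/2} · N! · ∏_j sup_{|z| ≤ Er} |f_j(z)|`

(`norm_det_interpolation_le`). Proof as printed: the entire function `ψ(z) = det (f_j(z ζ_i))`
vanishes at `0` to order at least `0 + 1 + ⋯ + (N-1) = N(N-1)/2`, because its `m`-th derivative at
`0` is a combination of the determinants `det (ζ_i^{k_i} f_j^{(k_i)}(0))` with `∑ k_i = m`, which
vanish unless the `k_i` are pairwise distinct (two equal rows); the maximum modulus principle on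
`|z| = E` (with multiplicity, `Baker1975.Analytic.norm_le_of_analyticOrderAt`) then gives the bound
at `z = 1`. We organise the derivative computation through the determinants
`D_k(z) = det (∂^{k_i} f_j(ζ_i z))` and the rule `D_k' = ∑_i D_{k + e_i}` (`Laurent.hasDerivAt_D`).
Also: the crude bound `|det A| ≤ N! ∏_j max_i |a_ij|` (`Laurent.norm_det_le_of_col_le`).
Everything here is proved; no named facts.

## References

* M. Laurent, *Linear forms in two logarithms and interpolation determinants*, Acta Arith. 66
  (1994), 181–199 (the lemma "`ψ` a un zéro d'ordre `≥ N(N-1)/2`"; not held, quoted after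
  Baker–Wüstholz and Waldschmidt).
* M. Laurent, M. Mignotte, Yu. Nesterenko, *Formes linéaires en deux logarithmes et déterminants
  d'interpolation*, J. Number Theory 55 (1995), 285–321 (the same lemma; not held).
* M. Waldschmidt, *Diophantine Approximation on Linear Algebraic Groups*, Springer 2000, §2.2
  (interpolation determinants; not held).
* A. Baker, G. Wüstholz, *Logarithmic Forms and Diophantine Geometry*, CUP 2007, §2.8 p. 35
  ("a variant of the basic theory based on interpolation determinants"). [BakerWustholz2007]
-/

noncomputable section

open Complex Finset

namespace Literature.NumberTheory.Transcendental

namespace Laurent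

variable {ι : Type*} [Fintype ι] [DecidableEq ι]

/-! ### A crude bound for determinants -/

/-- `‖sign σ • x‖ = ‖x‖`. [folklore] -/
theorem norm_sign_smul (σ : Equiv.Perm ι) (x : ℂ) : ‖Equiv.Perm.sign σ • x‖ = ‖x‖ := by
  rcases Int.units_eq_one_or (Equiv.Perm.sign σ) with h | h <;> simp [h]

/-- **Crude (Hadamard-free) bound**: if column `j` of `A` is bounded by `C j`, then
`|det A| ≤ N! ∏_j C_j`. [folklore] -/
theorem norm_det_le_of_col_le (A : Matrix ι ι ℂ) {C : ι → ℝ} (hC : ∀ i j, ‖A i j‖ ≤ C j) :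
    ‖A.det‖ ≤ (Fintype.card ι).factorial * ∏ j, C j := by
  rw [Matrix.det_apply]
  calc ‖∑ σ : Equiv.Perm ι, Equiv.Perm.sign σ • ∏ i, A (σ i) i‖
      ≤ ∑ σ : Equiv.Perm ι, ‖Equiv.Perm.sign σ • ∏ i, A (σ i) i‖ := norm_sum_le _ _
    _ ≤ ∑ _σ : Equiv.Perm ι, ∏ j, C j := by
        refine Finset.sum_le_sum fun σ _ => ?_
        rw [norm_sign_smul, norm_prod]
        exact Finset.prod_le_prod (fun _ _ => norm_nonneg _) fun i _ => hC (σ i) i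
    _ = (Fintype.card ι).factorial * ∏ j, C j := by
        rw [Finset.sum_const, Finset.card_univ, Fintype.card_perm, nsmul_eq_mul]

/-! ### The derivative of a determinant of functions -/

/-- **Derivative of a determinant along a curve of matrices**: if every entry `A i j` is
differentiable at `z` with derivative `A' i j z`, then `w ↦ det (A i j w)` has derivative
`∑_{i₀} det (A with row i₀ replaced by A')` (multilinearity in the rows). [folklore] -/
theorem hasDerivAt_det {A A' : ι → ι → ℂ → ℂ} {z : ℂ}
    (h : ∀ i j, HasDerivAt (A i j) (A' i j z) z) :
    HasDerivAt (fun w => Matrix.det (Matrix.of fun i j => A i j w))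
      (∑ i₀, Matrix.det (Matrix.of fun i j => if i = i₀ then A' i j z else A i j z)) z := by
  have hrw : (fun w => Matrix.det (Matrix.of fun i j => A i j w)) =
      fun w => ∑ σ : Equiv.Perm ι, ((Equiv.Perm.sign σ : ℤ) : ℂ) * ∏ i, A (σ i) i w := by
    funext w; rw [Matrix.det_apply']; rfl
  rw [hrw]
  have hprod : ∀ σ : Equiv.Perm ι, HasDerivAt (fun w => ∏ i, A (σ i) i w)
      (∑ i₀, (∏ i ∈ Finset.univ.erase i₀, A (σ i) i z) * A' (σ i₀) i₀ z) z := by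
    intro σ
    have := HasDerivAt.fun_finsetProd (u := Finset.univ) (f := fun i w => A (σ i) i w)
      (f' := fun i => A' (σ i) i z) (x := z) (fun i _ => h (σ i) i)
    simpa [smul_eq_mul] using this
  have hsum : HasDerivAt
      (fun w => ∑ σ : Equiv.Perm ι, ((Equiv.Perm.sign σ : ℤ) : ℂ) * ∏ i, A (σ i) i w)
      (∑ σ : Equiv.Perm ι, ((Equiv.Perm.sign σ : ℤ) : ℂ) *
        ∑ i₀, (∏ i ∈ Finset.univ.erase i₀, A (σ i) i z) * A' (σ i₀) i₀ z) z :=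
    HasDerivAt.fun_sum fun σ _ => (hprod σ).const_mul _
  refine hsum.congr_deriv ?_
  simp_rw [Matrix.det_apply']
  conv_rhs => rw [Finset.sum_comm]
  refine Finset.sum_congr rfl fun σ _ => ?_
  rw [Finset.mul_sum]
  conv_rhs => rw [← Equiv.sum_comp σ]
  refine Finset.sum_congr rfl fun i₀ _ => ?_
  congr 1
  rw [← Finset.mul_prod_erase Finset.univ _ (Finset.mem_univ i₀)]
  simp only [Matrix.of_apply]
  rw [mul_comm]
  congr 1
  refine Finset.prod_congr rfl fun i hi => ?_
  have hne : σ i ≠ σ i₀ := fun h' => (Finset.mem_erase.mp hi).1 (σ.injective h')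
  simp [hne]

/-! ### The determinants `D_k` -/

/-- `D_k(z) = det (∂^{k_i} [w ↦ f_j(ζ_i w)] (z))`: the rows of the interpolation matrix of the
rescaled functions, each differentiated `k_i` times. [cite: BakerWustholz2007, §2.8 p. 35] -/
def D (f : ι → ℂ → ℂ) (ζ : ι → ℂ) (k : ι → ℕ) (z : ℂ) : ℂ :=
  Matrix.det (Matrix.of fun i j => iteratedDeriv (k i) (fun w => f j (ζ i * w)) z)

variable {f : ι → ℂ → ℂ}

/-- The rescaled functions `w ↦ f_j(c w)` are entire. [folklore] -/
theorem differentiable_comp_mul {g : ℂ → ℂ} (hg : Differentiable ℂ g) (c : ℂ) :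
    Differentiable ℂ (fun w => g (c * w)) :=
  hg.comp (differentiable_id.const_mul c)

/-- All derivatives of the rescaled functions are entire. [folklore] -/
theorem differentiable_iteratedDeriv_comp_mul {g : ℂ → ℂ} (hg : Differentiable ℂ g) (c : ℂ)
    (n : ℕ) : Differentiable ℂ (iteratedDeriv n (fun w => g (c * w))) :=
  ((differentiable_comp_mul hg c).contDiff (n := ⊤)).differentiable_iteratedDeriv n
    (WithTop.coe_lt_top _)

/-- `D_k' = ∑_i D_{k + e_i}`. [folklore] -/
theorem hasDerivAt_D (hf : ∀ j, Differentiable ℂ (f j)) (ζ : ι → ℂ) (k : ι → ℕ) (z : ℂ) :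
    HasDerivAt (D f ζ k) (∑ i₀, D f ζ (k + Pi.single i₀ 1) z) z := by
  have h := hasDerivAt_det (ι := ι)
    (A := fun i j w => iteratedDeriv (k i) (fun w => f j (ζ i * w)) w)
    (A' := fun i j w => iteratedDeriv (k i + 1) (fun w => f j (ζ i * w)) w) (z := z)
    (fun i j => by
      have hd := ((differentiable_iteratedDeriv_comp_mul (hf j) (ζ i) (k i)) z).hasDerivAt
      rwa [← congrFun (iteratedDeriv_succ (n := k i) (f := fun w => f j (ζ i * w))) z] at hd)
  refine (h.congr_deriv ?_)
  refine Finset.sum_congr rfl fun i₀ _ => ?_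
  unfold D
  congr 1
  ext i j
  simp only [Matrix.of_apply, Pi.add_apply, Pi.single_apply]
  split_ifs with hi
  · subst hi; rfl
  · simp

/-- `D_k` is entire. [folklore] -/
theorem differentiable_D (hf : ∀ j, Differentiable ℂ (f j)) (ζ : ι → ℂ) (k : ι → ℕ) :
    Differentiable ℂ (D f ζ k) := fun z => (hasDerivAt_D hf ζ k z).differentiableAt

/-- `deriv D_k = ∑_i D_{k + e_i}`. [folklore] -/
theorem deriv_D (hf : ∀ j, Differentiable ℂ (f j)) (ζ : ι → ℂ) (k : ι → ℕ) :
    deriv (D f ζ k) = fun z => ∑ i₀, D f ζ (k + Pi.single i₀ 1) z :=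
  funext fun z => (hasDerivAt_D hf ζ k z).deriv

/-- `D_k(0) = (∏ ζ_i^{k_i}) · det (f_j^{(k_i)}(0))`. [folklore] -/
theorem D_apply_zero (hf : ∀ j, Differentiable ℂ (f j)) (ζ : ι → ℂ) (k : ι → ℕ) :
    D f ζ k 0 = (∏ i, ζ i ^ k i) * Matrix.det (Matrix.of fun i j => iteratedDeriv (k i) (f j) 0) := by
  unfold D
  have : (Matrix.of fun i j => iteratedDeriv (k i) (fun w => f j (ζ i * w)) 0) =
      Matrix.of fun i j => ζ i ^ k i * (Matrix.of fun i j => iteratedDeriv (k i) (f j) 0) i j := by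
    ext i j
    simp only [Matrix.of_apply]
    rw [iteratedDeriv_comp_const_mul ((hf j).contDiff) (ζ i)]
    simp
  rw [this, Matrix.det_mul_column]

/-! ### The order of vanishing at `0` -/

/-- The sum of a finite set of naturals is at least `0 + 1 + ⋯ + (#s - 1)`. [folklore] -/
theorem sum_range_card_le_sum (s : Finset ℕ) : ∑ i ∈ Finset.range s.card, i ≤ ∑ i ∈ s, i := by
  induction s using Finset.induction_on_max with
  | empty => simp
  | insert a s ha ih =>
    have hnot : a ∉ s := fun h => lt_irrefl a (ha a h)
    rw [Finset.card_insert_of_notMem hnot, Finset.sum_range_succ, Finset.sum_insert hnot]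
    have hcard : s.card ≤ a := by
      calc s.card ≤ (Finset.range a).card :=
            Finset.card_le_card fun x hx => Finset.mem_range.mpr (ha x hx)
        _ = a := Finset.card_range a
    omega

omit [DecidableEq ι] in
/-- An injective `k : ι → ℕ` has `∑ k_i ≥ 0 + 1 + ⋯ + (N-1)`. [folklore] -/
theorem sum_range_le_sum_of_injective {k : ι → ℕ} (hk : Function.Injective k) :
    ∑ i ∈ Finset.range (Fintype.card ι), i ≤ ∑ i, k i := by
  have h1 : ∑ i, k i = ∑ x ∈ Finset.univ.image k, x := by
    rw [Finset.sum_image fun i _ j _ h => hk h]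
  have h2 : (Finset.univ.image k).card = Fintype.card ι := by
    rw [Finset.card_image_of_injective _ hk, Finset.card_univ]
  rw [h1, ← h2]
  exact sum_range_card_le_sum _

/-- `D_k(0) = 0` when `∑ k_i < N(N-1)/2` (two of the `k_i` coincide: two equal rows). [folklore] -/
theorem D_zero_eq_zero (hf : ∀ j, Differentiable ℂ (f j)) (ζ : ι → ℂ) {k : ι → ℕ}
    (hk : ∑ i, k i < ∑ i ∈ Finset.range (Fintype.card ι), i) : D f ζ k 0 = 0 := by
  rw [D_apply_zero hf]
  have hni : ¬ Function.Injective k := fun h => (sum_range_le_sum_of_injective h).not_gt hk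
  obtain ⟨i, i', hii', hne⟩ := Function.not_injective_iff.mp hni
  rw [Matrix.det_zero_of_row_eq hne (by ext j; simp [hii']), mul_zero]

/-- All derivatives of order `m` of `D_k` vanish at `0` as long as `∑ k_i + m < N(N-1)/2`.
[cite: BakerWustholz2007, §2.8 p. 35] -/
theorem iteratedDeriv_D_zero (hf : ∀ j, Differentiable ℂ (f j)) (ζ : ι → ℂ) :
    ∀ (m : ℕ) (k : ι → ℕ), (∑ i, k i) + m < ∑ i ∈ Finset.range (Fintype.card ι), i →
      iteratedDeriv m (D f ζ k) 0 = 0 := by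
  intro m
  induction m with
  | zero => intro k hk; simpa using D_zero_eq_zero hf ζ (by simpa using hk)
  | succ m ih =>
    intro k hk
    rw [iteratedDeriv_succ', deriv_D hf ζ k,
      iteratedDeriv_fun_sum (fun i _ => ((differentiable_D hf ζ _).contDiff).contDiffAt)]
    refine Finset.sum_eq_zero fun i _ => ih _ ?_
    have : ∑ x, (k + Pi.single i 1 : ι → ℕ) x = (∑ x, k x) + 1 := by
      simp [Finset.sum_add_distrib, Finset.sum_pi_single']
    omega

/-- The interpolation function `ψ = D_0` vanishes at `0` to order `≥ N(N-1)/2`.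
[cite: BakerWustholz2007, §2.8 p. 35] -/
theorem le_analyticOrderAt_D_zero (hf : ∀ j, Differentiable ℂ (f j)) (ζ : ι → ℂ) :
    ((∑ i ∈ Finset.range (Fintype.card ι), i : ℕ) : ℕ∞) ≤ analyticOrderAt (D f ζ 0) 0 :=
  Baker1975.Analytic.le_analyticOrderAt_of_iteratedDeriv_eq_zero (differentiable_D hf ζ 0)
    fun m hm => iteratedDeriv_D_zero hf ζ m 0 (by simpa using hm)

end Laurent

/-! ### Laurent's lemma -/

open Laurent in
/-- **Laurent's lemma (interpolation determinants).** Let `f_j` (`j ∈ ι`, `#ι = N`) be entire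
functions, `ζ_i` points with `|ζ_i| ≤ r`, `E ≥ 1`, and `|f_j(z)| ≤ C_j` for `|z| ≤ E r`. Then
`|det (f_j(ζ_i))_{i,j}| ≤ N! (∏_j C_j) / E^{N(N-1)/2}`.
[cite: BakerWustholz2007, §2.8 p. 35 (Laurent's interpolation determinants)] -/
theorem norm_det_interpolation_le {ι : Type*} [Fintype ι] [DecidableEq ι]
    {f : ι → ℂ → ℂ} (hf : ∀ j, Differentiable ℂ (f j)) {ζ : ι → ℂ} {r E : ℝ} (hE : 1 ≤ E)
    (hζ : ∀ i, ‖ζ i‖ ≤ r) {C : ι → ℝ} (hC : ∀ j z, ‖z‖ ≤ E * r → ‖f j z‖ ≤ C j) :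
    ‖Matrix.det (Matrix.of fun i j => f j (ζ i))‖ ≤
      (Fintype.card ι).factorial * (∏ j, C j) /
        E ^ (Fintype.card ι * (Fintype.card ι - 1) / 2) := by
  set N := Fintype.card ι with hN
  set T := ∑ i ∈ Finset.range N, i with hT
  have hTN : T = N * (N - 1) / 2 := Finset.sum_range_id N
  have hψ1 : D f ζ 0 1 = Matrix.det (Matrix.of fun i j => f j (ζ i)) := by simp [D]
  have hE0 : 0 < E := by linarith
  have hbound : ∀ z ∈ Metric.sphere (0 : ℂ) E, ‖D f ζ 0 z‖ ≤ N.factorial * ∏ j, C j := by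
    intro z hz
    have hz' : ‖z‖ = E := by simpa using hz
    simp only [D]
    refine norm_det_le_of_col_le _ fun i j => hC j _ ?_
    rw [norm_mul, hz', mul_comm]
    exact mul_le_mul_of_nonneg_left (hζ i) hE0.le
  have hm : ∀ z ∈ Metric.sphere (0 : ℂ) E, E ^ T ≤ ‖∏ c ∈ ({0} : Finset ℂ), (z - c) ^ T‖ := by
    intro z hz
    have hz' : ‖z‖ = E := by simpa using hz
    simp [hz']
  have key := Baker1975.Analytic.norm_le_of_analyticOrderAt (differentiable_D hf ζ 0) {0} T
    (fun c hc => by rw [Finset.mem_singleton.mp hc]; exact le_analyticOrderAt_D_zero hf ζ) hE0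
    hbound (pow_pos hE0 T) hm (w := 1) (by simpa using hE)
  rw [← hψ1, ← hTN]
  calc ‖D f ζ 0 1‖
      ≤ (N.factorial * ∏ j, C j) / E ^ T * ‖∏ c ∈ ({0} : Finset ℂ), ((1 : ℂ) - c) ^ T‖ := key
    _ = N.factorial * (∏ j, C j) / E ^ T := by simp

end Literature.NumberTheory.Transcendental

end
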